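import Summits.QuantumFields.BalabanUV.Beta.D1BFx.RoadPinKernelDecay
import Summits.QuantumFields.BalabanUV.Beta.D1BFx.StraightPinMultiplierEnvelope

/-!
# `BalabanUV.Beta.D1BFx.StraightPinLegSup` — road «BF-x», binder row D1, PART 24-hyb HEAD ON THE SCALES: **THE LEG LETTER `hK₀ : ∀ m, Bdd (KInvStep 3 (Lc^m) 0) S₀`
# OF EVERY SCALES ROW REDUCED TO THE ff LETTER `hΓ` — ONE `S₀` FOR ALL SCALES**, «K0-BDD-UNIFORM».
# The scales files of the HEAD (`ChartDefectRowRestScales` (rest), leaf-03 g34's TT33–TT35 (lamf)(ms)(mcol)) display the straight one-shot kernel's sup as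
# `hK₀ : ∀ m, Bdd (KInvStep 3 (Lc^m) 0) S₀`.  In the tree that kernel is assembled from four blocks (g62 «G0-DECAY» `RoadPinKernelDecay.decays_K₀_of_blocks`):
# ff = `Γ` (letter `hΓ`), fm ∕ mf = the `ℋ`-columns (`(n⁵)⁻¹·C₄e^{κ′}`, UNCONDITIONAL), mm = `wΦ` (`(2·c166Z 3)·(n⁵)⁻¹(n³)⁻¹·e^{kappaZ 3}`, UNCONDITIONAL since leaf-04 g28's
# «WPHI-ENVELOPE» `StraightPinMultiplierEnvelope.abs_wΦ_le_hΦ`).  Hence, for EVERY block size `n ≥ 1`,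
# `Bdd (KInvStep 3 n 0) (CΓ + 2·C₄e^{κ′} + (2·c166Z 3)·e^{kappaZ 3})` modulo `hΓ` at that `n` alone (`(n⁵)⁻¹ ≤ 1`, `(n⁵)⁻¹(n³)⁻¹ ≤ 1`), and on the scales
# `hΓ : ∀ m κ x l x′, |Γ^{(Lc^m)} κ x l x′| ≤ CΓ·e^{−δΓ|x−x′|₁}` (ONE `CΓ`, `0 ≤ δΓ`, for all `m`) ⟹ `∀ m, Bdd (KInvStep 3 (Lc^m) 0) S₀*`, `S₀* := CΓ + 2·C₄e^{κ′} + (2·c166Z 3)·e^{kappaZ 3}`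
# — NO `m`, NO `Lc`.  So every scales row's `hK₀` is ONE APPLICATION away from the (K)-wall's ff letter, the same `S₀*` for all rows.

HONEST DEPENDENCY (cell records, verbatim): «continuum YM on T⁴ ⇐ BetaPertH ∧ nine spine estimates (0/9 proved); BetaPertH ⇐ (D1) ∧ (D4) ∧
CAP+tail; G-an2-4 gates asym, D1 and NE2/3/4.»  HONEST FRAMING (cell contract, verbatim): «discharging `BetaPertH` makes Bałaban's UV stability
UNCONDITIONAL — a real constructive-QFT result; it is NOT the continuum limit and NOT the Clay problem.»  THIS MODULE is [folklore] bookkeeping BY NAME over landed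
objects (`decays_K₀_of_blocks`, lit `KernelWard.bdd_of_decays`, `abs_wΦ_le_hΦ`, `kappaZ_three_pos`) and real arithmetic.  No `def`, no `def … : Prop`, nothing cited,
0 sorry, default heartbeats.  It asserts NO n-law of `(CΓ, δΓ)` — the ff block `Γ^{(n)}` (the KKT fluctuation covariance in the straight gauge) is the (K)-wall's object
and `hΓ` stays a DISPLAYED hypothesis; it prices NO row; 0∕4 row-D1 binders (hW ∕ hR ∕ D1Tel ∕ D1Rep); (K) NOT closed; (J1) ONE OPEN ROW; NOT D1,
NEVER «G-an2-4 closed», NOT `BetaPertH`, NOT continuum, NOT Clay.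

ABSOLUTE RULE (cell charter, verbatim): «No internally-minted statement may enter as a cited fact. Every hypothesis is either kernel-proved in
this package or a verbatim quotation of a PUBLISHED theorem with page reference. The manuscript(s) under audit are NOT citable for their own
disputed steps — they are the thing under adjudication; programme-internal (2001/route/tribunal) claims are never citable.»

CONTENT.
* §1 [folklore] `legSupConst_nonneg` (`0 ≤ CΓ → 0 ≤ S₀*`), `legConst_le_legSupConst` (the n-dependent constant of `decays_K₀_of_blocks` at `CΦ := 2·c166Z 3`, `κ₀ := kappaZ 3`
  is `≤ S₀*` for `1 ≤ n`).
* §2 **`bdd_K₀_of_hΓ`** (`[NeZero n]`; `0 ≤ CΓ`, `0 ≤ δΓ`, `hΓ` at block size `n`): `Bdd (KInvStep 3 n 0) S₀*`.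
* §3 **`bdd_K₀_scales_of_hΓ`** (`Lc ≠ 0`; `hΓ : ∀ m …` with one `CΓ`, `δΓ`): `∀ m, Bdd (KInvStep 3 (Lc^m) 0) S₀*` — the `hK₀` binder of `ChartDefectRowRestScales.row_rest_scales`
  and of leaf-03's `row_lamf_scales ∕ row_ms_scales ∕ row_mcol_scales` VERBATIM (take `S₀ := S₀*`, `hS₀ := legSupConst_nonneg hCΓ`, `hK₀ := bdd_K₀_scales_of_hΓ hCΓ hδΓ hΓ`).
NOT HERE (honest): `hΓ` itself (the wall's); the rows; the HEAD.
Unit `b2b-balaban-gan24-formalise-leaf-05` (gen 64), G-an2-4 swarm leaf prover 05, road «BF-x» supplier; INTENT-3 «K0-BDD-UNIFORM» (journal).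
Not in print; our bookkeeping.  No existing file touched.
-/

noncomputable section

open Literature.MathematicalPhysics.QuantumFieldTheory
open Literature.MathematicalPhysics.QuantumFieldTheory.Balaban1983to89
open Literature.MathematicalPhysics.QuantumFieldTheory.Balaban1983to89.Beta
open B12Sec2to5 (l1)
open B4ContourShift (supNorm)
open B5Hk163Strip (kappa163 kappa163_pos)
open B5Hk163Decay (MG163 MG163_nonneg)
open B4TorusKernel (periodConst)
open B5Kernel166Decay (periodConst_pos)
open B5Symbol166Strip (MG_pos)
open ExpKernelCalculus (Site MKer Decays)
open KernelSpecInstance (wΦ)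
open KernelWard (Bdd bdd_of_decays)
open KKTFluctuationKernel (Gam)
open OneStepResolventKernel (Fib)
open OneStepKernelFamily (KInvStep)
open Summit.QuantumFields.BalabanUV.Beta.GAN24.DirichletExhaustionDeltaZ (c166Z kappaZ kappaZ_pos)
open Summit.QuantumFields.BalabanUV.Beta.D1BFx.RoadPinKernelDecay (decays_K₀_of_blocks)
open Summit.QuantumFields.BalabanUV.Beta.D1BFx.StraightPinMultiplierEnvelope (abs_wΦ_le_hΦ kappaZ_three_pos)

namespace Summit.QuantumFields.BalabanUV.Beta.D1BFx.StraightPinLegSup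

/-! ## §1 The uniform leg constant `S₀* = CΓ + 2·C₄e^{κ′} + (2·c166Z 3)·e^{kappaZ 3}` -/

/-- [folklore] `0 ≤ CΓ ⟹ 0 ≤ S₀* := CΓ + 2·C₄e^{κ′} + (2·c166Z 3)·e^{kappaZ 3}` (`C₄ = MG163 4·periodConst (kappa163 4) 3`, `κ′ = kappa163 4∕4`). -/
theorem legSupConst_nonneg {CΓ : ℝ} (hCΓ : 0 ≤ CΓ) :
    0 ≤ CΓ + 2 * ((MG163 4 * periodConst (kappa163 4) 3) * Real.exp (kappa163 4 / 4)) + (2 * c166Z 3) * Real.exp (kappaZ 3) := by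
  have h1 : 0 ≤ MG163 4 := MG163_nonneg 4
  have h2 : 0 ≤ periodConst (kappa163 4) 3 := (periodConst_pos (kappa163_pos 4) 3).le
  have h3 : 0 ≤ c166Z 3 := by unfold c166Z; have := MG_pos (3 + 1); positivity
  positivity

/-- [folklore] For `1 ≤ n` the block-size-`n` constant of `decays_K₀_of_blocks` (at `CΦ := 2·c166Z 3`, `κ₀ := kappaZ 3`) is at most `S₀*`:
`CΓ + (n⁵)⁻¹C₄e^{κ′} + (n⁵)⁻¹C₄e^{κ′} + (2·c166Z 3)·(n⁵)⁻¹(n³)⁻¹e^{kappaZ 3} ≤ CΓ + 2·C₄e^{κ′} + (2·c166Z 3)·e^{kappaZ 3}`. -/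
theorem legConst_le_legSupConst {n : ℕ} (hn : 1 ≤ n) (CΓ : ℝ) :
    CΓ + (((n : ℝ) ^ 5)⁻¹ * ((MG163 4 * periodConst (kappa163 4) 3) * Real.exp (kappa163 4 / 4)))
        + (((n : ℝ) ^ 5)⁻¹ * ((MG163 4 * periodConst (kappa163 4) 3) * Real.exp (kappa163 4 / 4)))
        + ((2 * c166Z 3) * ((n : ℝ) ^ 5)⁻¹ * ((n : ℝ) ^ 3)⁻¹ * Real.exp (kappaZ 3))
      ≤ CΓ + 2 * ((MG163 4 * periodConst (kappa163 4) 3) * Real.exp (kappa163 4 / 4)) + (2 * c166Z 3) * Real.exp (kappaZ 3) := by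
  have hn' : (1 : ℝ) ≤ n := by exact_mod_cast hn
  have hC : 0 ≤ (MG163 4 * periodConst (kappa163 4) 3) * Real.exp (kappa163 4 / 4) := by
    have h1 : 0 ≤ MG163 4 := MG163_nonneg 4
    have h2 : 0 ≤ periodConst (kappa163 4) 3 := (periodConst_pos (kappa163_pos 4) 3).le
    positivity
  have hZ : 0 ≤ (2 * c166Z 3) * Real.exp (kappaZ 3) := by
    have h3 : 0 ≤ c166Z 3 := by unfold c166Z; have := MG_pos (3 + 1); positivity
    positivity
  have h5 : ((n : ℝ) ^ 5)⁻¹ ≤ 1 := inv_le_one_of_one_le₀ (one_le_pow₀ hn')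
  have h3 : ((n : ℝ) ^ 3)⁻¹ ≤ 1 := inv_le_one_of_one_le₀ (one_le_pow₀ hn')
  have h50 : 0 ≤ ((n : ℝ) ^ 5)⁻¹ := by positivity
  have h30 : 0 ≤ ((n : ℝ) ^ 3)⁻¹ := by positivity
  have ha : ((n : ℝ) ^ 5)⁻¹ * ((MG163 4 * periodConst (kappa163 4) 3) * Real.exp (kappa163 4 / 4))
      ≤ (MG163 4 * periodConst (kappa163 4) 3) * Real.exp (kappa163 4 / 4) := by
    calc ((n : ℝ) ^ 5)⁻¹ * ((MG163 4 * periodConst (kappa163 4) 3) * Real.exp (kappa163 4 / 4))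
        ≤ 1 * ((MG163 4 * periodConst (kappa163 4) 3) * Real.exp (kappa163 4 / 4)) := mul_le_mul_of_nonneg_right h5 hC
      _ = _ := one_mul _
  have hb : (2 * c166Z 3) * ((n : ℝ) ^ 5)⁻¹ * ((n : ℝ) ^ 3)⁻¹ * Real.exp (kappaZ 3) ≤ (2 * c166Z 3) * Real.exp (kappaZ 3) := by
    have e : (2 * c166Z 3) * ((n : ℝ) ^ 5)⁻¹ * ((n : ℝ) ^ 3)⁻¹ * Real.exp (kappaZ 3)
        = (((n : ℝ) ^ 5)⁻¹ * ((n : ℝ) ^ 3)⁻¹) * ((2 * c166Z 3) * Real.exp (kappaZ 3)) := by ring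
    rw [e]
    calc (((n : ℝ) ^ 5)⁻¹ * ((n : ℝ) ^ 3)⁻¹) * ((2 * c166Z 3) * Real.exp (kappaZ 3))
        ≤ 1 * ((2 * c166Z 3) * Real.exp (kappaZ 3)) :=
          mul_le_mul_of_nonneg_right (by nlinarith) hZ
      _ = _ := one_mul _
  linarith

/-! ## §2 The straight one-shot kernel's sup modulo `hΓ` alone, every block size -/

section Block

variable (n : ℕ) [NeZero n]

/-- [our objects + folklore] **«K0-BDD» MODULO `hΓ` ALONE, n-FREE CONSTANT**: if the ff block obeys `|Γ^{(n)} κ x l x′| ≤ CΓ·e^{−δΓ|x−x′|₁}` (`0 ≤ CΓ`, `0 ≤ δΓ`),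
then `Bdd (KInvStep 3 n 0) (CΓ + 2·C₄e^{κ′} + (2·c166Z 3)·e^{kappaZ 3})` — g62 `decays_K₀_of_blocks` with leaf-04 g28's hypothesis-free `hΦ := abs_wΦ_le_hΦ n`,
lit `bdd_of_decays` (rate `min δΓ (…) ≥ 0`), then `legConst_le_legSupConst`.  The constant mentions no `n`. -/
theorem bdd_K₀_of_hΓ {CΓ δΓ : ℝ} (hCΓ : 0 ≤ CΓ) (hδΓ : 0 ≤ δΓ)
    (hΓ : ∀ (κ : Fin (3 + 1)) (x : Site 4) (l : Fin (3 + 1)) (x' : Site 4),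
      |Gam (N := n) κ x l x'| ≤ CΓ * Real.exp (-δΓ * l1 (x - x'))) :
    Bdd (KInvStep (d := 3) n 0)
      (CΓ + 2 * ((MG163 4 * periodConst (kappa163 4) 3) * Real.exp (kappa163 4 / 4)) + (2 * c166Z 3) * Real.exp (kappaZ 3)) := by
  have hn : 1 ≤ n := Nat.one_le_iff_ne_zero.2 (NeZero.ne n)
  have hn' : (0 : ℝ) < n := by exact_mod_cast hn
  have hD := decays_K₀_of_blocks n hCΓ hΓ kappaZ_three_pos (abs_wΦ_le_hΦ n)
  have hδ : 0 ≤ min δΓ (min (kappa163 4 / 4 / (4 * (n : ℝ))) (kappaZ 3 / (4 * (n : ℝ)))) := by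
    have := kappa163_pos 4; have := kappaZ_pos 3
    exact le_min hδΓ (le_min (by positivity) (by positivity))
  have hB := bdd_of_decays hD hδ
  intro x y a b
  exact (hB x y a b).trans (legConst_le_legSupConst hn CΓ)

end Block

/-! ## §3 On the scales `n := Lc^m`: the `hK₀` binder of every scales row, one `S₀*` for all `m` -/

/-- **«K0-BDD-UNIFORM» — THE SCALES ROWS' LEG LETTER FROM THE ff LETTER** [our objects + folklore]: if for all scales `m` the ff block of the straight kernel at
block size `Lc^m` obeys `|Γ^{(Lc^m)} κ x l x′| ≤ CΓ·e^{−δΓ|x−x′|₁}` with ONE `CΓ ≥ 0` and ONE `δΓ ≥ 0`, then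
`∀ m, Bdd (KInvStep 3 (Lc^m) 0) (CΓ + 2·C₄e^{κ′} + (2·c166Z 3)·e^{kappaZ 3})` — the binder `hK₀` of `ChartDefectRowRestScales.row_rest_scales` (this lineage) and of
leaf-03 g34's `row_lamf_scales ∕ row_ms_scales ∕ row_mcol_scales` VERBATIM with `S₀ := S₀*` (and `hS₀ := legSupConst_nonneg hCΓ`).  `NeZero (Lc^m)` from `NeZero Lc`.
Asserts NO n-law of `(CΓ, δΓ)`: `hΓ` is the (K)-wall's letter and stays displayed. -/
theorem bdd_K₀_scales_of_hΓ {Lc : ℕ} [NeZero Lc] {CΓ δΓ : ℝ} (hCΓ : 0 ≤ CΓ) (hδΓ : 0 ≤ δΓ)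
    (hΓ : ∀ (m : ℕ) (κ : Fin (3 + 1)) (x : Site 4) (l : Fin (3 + 1)) (x' : Site 4),
      |Gam (N := Lc ^ m) κ x l x'| ≤ CΓ * Real.exp (-δΓ * l1 (x - x'))) :
    ∀ m : ℕ, Bdd (KInvStep (d := 3) (Lc ^ m) 0)
      (CΓ + 2 * ((MG163 4 * periodConst (kappa163 4) 3) * Real.exp (kappa163 4 / 4)) + (2 * c166Z 3) * Real.exp (kappaZ 3)) :=
  fun m => bdd_K₀_of_hΓ (Lc ^ m) hCΓ hδΓ (hΓ m)

end Summit.QuantumFields.BalabanUV.Beta.D1BFx.StraightPinLegSup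

end
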